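import Mathlib.Analysis.FunctionalSpaces.SobolevInequality
import Mathlib.Analysis.SpecialFunctions.SmoothTransition
import Literature.Analysis.Calculus.HardyExterior
import Literature.Analysis.FluidPDE.WholeSpaceIBP
import HarnessLib

/-!
# The Sobolev inequality outside a ball, without boundary conditions on the inner sphere

(namespace `Literature.Analysis.Calculus`; companion of `HardyExterior.lean`.)

Schoen–Yau, Comm. Math. Phys. 65 (1979), proof of Lemma 3.1 (p. 63): on the end
`N_k ≅ ℝ³ ∖ B_{σ₀}` of an asymptotically flat manifold, whose metric is uniformly equivalent to the
Euclidean one, *"we have the inequality which follows from the Euclidean inequality (see proof in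
[17, p. 80–81])"* `(∫_{N_k} ζ⁶)^{1/3} ≤ const ∫_{N_k} ‖Dζ‖²` for functions `ζ` with compact
support on `N` — which need **not** vanish on the inner boundary sphere of `N_k`. This file proves
the underlying Euclidean statement, in the form with a loss of domain that the cut-off argument
gives directly: for a real inner product space `E` of dimension `3`, radii `0 < R < R₀`, and
`u : E → ℝ` of class `C¹` on `{R < ‖y‖}` vanishing outside some ball,

  `‖u‖_{L⁶({2R₀ < ‖y‖})} ≤ K (1 + 4c) ‖Du‖_{L²({R₀ < ‖y‖})}`

(`eLpNorm_six_exterior_le`; and for the truncation `(1 − χ_{R₀}) u` on all of `E`,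
`eLpNorm_six_cutoff_mul_le`), `K` Mathlib's Gagliardo–Nirenberg–Sobolev constant
`SNormLESNormFDerivOfEqConst ℝ volume 2` and `c` the absolute gradient bound of the tree's cut-off
`Fluid.cutoff` (`Fluid.exists_norm_fderiv_cutoff_le`). Ingredients, all in the tree or Mathlib:

* `sq_integral_annulus_le` — **the annulus is controlled by the gradient**:
  `∫_{R₀ < ‖y‖ ≤ 2R₀} u² ≤ 16 R₀² ∫_{R₀ < ‖y‖} ‖Du‖²`, from Hardy's inequality outside a ball
  (`hardy_sq_integral_exterior_le`, `HardyExterior.lean`: `∫_{‖y‖>R₀} u²/‖y‖² ≤ 4 ∫ ‖Du‖²`, no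
  boundary term) applied to `ψ₀ u` with a cut-off `ψ₀ = 1` on `{R₀ ≤ ‖y‖}`, `= 0` near the ball
  `{‖y‖ ≤ R}`;
* the Gagliardo–Nirenberg–Sobolev inequality for `w = ψ u ∈ C¹_c(E)`, `ψ = 1 − χ_{R₀}`
  (`= 0` on `{‖y‖ ≤ R₀}`, `= 1` on `{2R₀ ≤ ‖y‖}`, `‖Dψ‖ ≤ c/R₀`), Mathlib's
  `eLpNorm_le_eLpNorm_fderiv_of_eq` with `n = 3`, `p = 2`, `p' = 6`, and the Leibniz bound
  `‖Dw‖ ≤ 1_{R₀<‖y‖} ‖Du‖ + (c/R₀) 1_{R₀<‖y‖≤2R₀} |u|` (off two spheres, which are null).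

## References

* R. Schoen, S.-T. Yau, *On the proof of the positive mass conjecture in general relativity*,
  Comm. Math. Phys. 65 (1979) 45–76, proof of Lemma 3.1 (p. 63).
* D. Gilbarg, N. S. Trudinger, *Elliptic Partial Differential Equations of Second Order*,
  Springer (1977 ed.), pp. 80–81 (= 2001 ed., §7.7), the Sobolev inequality (reference [17] of
  Schoen–Yau).
* L. C. Evans, *Partial Differential Equations*, 2nd ed. (2010), §5.6.1.
-/

noncomputable section

open MeasureTheory Set Filter Metric Function Module
open scoped Topology ENNReal NNReal ContDiff

namespace Literature.Analysis.Calculus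

open Literature.Analysis.FluidPDE

variable {E : Type*} [NormedAddCommGroup E] [InnerProductSpace ℝ E] [FiniteDimensional ℝ E]
  [MeasurableSpace E] [BorelSpace E]

/-! ### Cut-offs adapted to two radii -/

omit [FiniteDimensional ℝ E] [MeasurableSpace E] [BorelSpace E] in
/-- **A smooth radial cut-off between two radii**: for `0 ≤ a < b` there is a smooth
`ψ₀ : E → [0, 1]` with `ψ₀ = 0` on `{‖y‖ ≤ a}` and `ψ₀ = 1` on `{b ≤ ‖y‖}`
(`Real.smoothTransition` of an affine function of `‖y‖²`). [folklore] -/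
theorem exists_smooth_radial_cutoff_between {a b : ℝ} (ha : 0 ≤ a) (hab : a < b) :
    ∃ ψ₀ : E → ℝ, ContDiff ℝ ∞ ψ₀ ∧ (∀ y, ‖y‖ ≤ a → ψ₀ y = 0) ∧ (∀ y, b ≤ ‖y‖ → ψ₀ y = 1) ∧
      ∀ y, ψ₀ y ∈ Icc (0 : ℝ) 1 := by
  have hden : 0 < b ^ 2 - a ^ 2 := by nlinarith
  refine ⟨fun y ↦ Real.smoothTransition ((‖y‖ ^ 2 - a ^ 2) / (b ^ 2 - a ^ 2)), ?_,
    fun y hy ↦ ?_, fun y hy ↦ ?_, fun y ↦ ⟨Real.smoothTransition.nonneg _,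
      Real.smoothTransition.le_one _⟩⟩
  · exact Real.smoothTransition.contDiff.comp
      (((contDiff_norm_sq ℝ).sub contDiff_const).div_const _)
  · refine Real.smoothTransition.zero_of_nonpos (div_nonpos_of_nonpos_of_nonneg ?_ hden.le)
    have h1 : ‖y‖ ^ 2 ≤ a ^ 2 := pow_le_pow_left₀ (norm_nonneg y) hy 2
    linarith
  · refine Real.smoothTransition.one_of_one_le ((one_le_div hden).2 ?_)
    have h1 : b ^ 2 ≤ ‖y‖ ^ 2 := pow_le_pow_left₀ (by linarith) hy 2
    linarith

omit [FiniteDimensional ℝ E] [MeasurableSpace E] [BorelSpace E] in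
/-- A product `ψ u` with `ψ` smooth, vanishing on an open ball `{‖y‖ < a}`, and `u` of class `C¹`
on `{R < ‖y‖}`, `R < a`, is `C¹` on the whole space. [folklore] -/
theorem contDiff_cutoff_mul {ψ u : E → ℝ} (hψ : ContDiff ℝ 1 ψ) {R a : ℝ} (hRa : R < a)
    (hψ0 : ∀ y, ‖y‖ < a → ψ y = 0) (hu : ContDiffOn ℝ 1 u {y | R < ‖y‖}) :
    ContDiff ℝ 1 fun y ↦ ψ y * u y := by
  rw [contDiff_iff_contDiffAt]
  intro y
  by_cases hy : R < ‖y‖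
  · exact hψ.contDiffAt.mul (hu.contDiffAt ((isOpen_lt continuous_const continuous_norm).mem_nhds hy))
  · have hya : ‖y‖ < a := lt_of_le_of_lt (not_lt.1 hy) hRa
    have hev : (fun y ↦ ψ y * u y) =ᶠ[𝓝 y] fun _ ↦ 0 := by
      filter_upwards [(isOpen_lt continuous_norm continuous_const).mem_nhds hya] with z hz
      rw [hψ0 z hz, zero_mul]
    exact contDiffAt_const.congr_of_eventuallyEq hev

omit [MeasurableSpace E] [BorelSpace E] in
/-- If `u` vanishes outside the ball of radius `ρ`, so does `ψ u`, which therefore has compact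
support. [folklore] -/
theorem hasCompactSupport_cutoff_mul {ψ u : E → ℝ} {ρ : ℝ} (hρ : ∀ y, ρ ≤ ‖y‖ → u y = 0) :
    HasCompactSupport fun y ↦ ψ y * u y := by
  refine HasCompactSupport.intro' (isCompact_closedBall (0 : E) ρ) isClosed_closedBall fun y hy ↦ ?_
  rw [mem_closedBall_zero_iff, not_le] at hy
  rw [hρ y hy.le, mul_zero]

/-! ### The annulus is controlled by the gradient (Hardy) -/

/-- **`∫_{R₀ < ‖y‖ ≤ 2R₀} u² ≤ 16 R₀² ∫_{R₀ < ‖y‖} ‖Du‖²`** in dimension `3`, for `u` of class `C¹`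
on `{R < ‖y‖}` (`0 < R < R₀`) vanishing outside some ball: Hardy's inequality outside the ball of
radius `R₀` (`hardy_sq_integral_exterior_le`, constant `4` for `n = 3`, no boundary term) applied
to `ψ₀ u ∈ C¹_c(E)` with `ψ₀ = 1` on `{R₀ ≤ ‖y‖}`, `ψ₀ = 0` near `{‖y‖ ≤ R}`, and
`u² ≤ (2R₀)² u²/‖y‖²` on the annulus. [cite: SchoenYauPMT1979, proof of Lemma 3.1 (p. 63)] -/
theorem sq_integral_annulus_le (hE : finrank ℝ E = 3) {u : E → ℝ} {R R₀ : ℝ} (hR : 0 < R)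
    (hRR₀ : R < R₀) (hu : ContDiffOn ℝ 1 u {y | R < ‖y‖}) {ρ : ℝ} (hρ : ∀ y, ρ ≤ ‖y‖ → u y = 0) :
    ∫ y in {y : E | R₀ < ‖y‖ ∧ ‖y‖ ≤ 2 * R₀}, u y ^ 2 ≤
      16 * R₀ ^ 2 * ∫ y in {y : E | R₀ < ‖y‖}, ‖fderiv ℝ u y‖ ^ 2 := by
  have hR₀ : 0 < R₀ := hR.trans hRR₀
  set S : Set E := {y | R₀ < ‖y‖} with hS
  set A : Set E := {y : E | R₀ < ‖y‖ ∧ ‖y‖ ≤ 2 * R₀} with hA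
  have hSo : IsOpen S := isOpen_lt continuous_const continuous_norm
  have hSm : MeasurableSet S := hSo.measurableSet
  have hAm : MeasurableSet A :=
    hSm.inter (isClosed_le continuous_norm continuous_const).measurableSet
  have hAS : A ⊆ S := fun y hy ↦ hy.1
  -- the inner cut-off and `ũ = ψ₀ u`
  set a : ℝ := (R + R₀) / 2 with ha
  have hRa : R < a := by rw [ha]; linarith
  have haR₀ : a < R₀ := by rw [ha]; linarith
  obtain ⟨ψ₀, hψ₀s, hψ₀0, hψ₀1, hψ₀b⟩ := exists_smooth_radial_cutoff_between (E := E)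
    (by rw [ha]; linarith) haR₀
  set ut : E → ℝ := fun y ↦ ψ₀ y * u y with hut
  have hut1 : ContDiff ℝ 1 ut :=
    contDiff_cutoff_mul (hψ₀s.of_le (by exact_mod_cast le_top)) hRa
      (fun y hy ↦ hψ₀0 y hy.le) hu
  have hutc : HasCompactSupport ut := hasCompactSupport_cutoff_mul hρ
  -- Hardy for `ũ`
  have hH := hardy_sq_integral_exterior_le hut1 hutc hR₀ (by rw [hE])
  rw [hE] at hH
  norm_num at hH
  -- on `S`, `ũ = u` and `Dũ = Du`
  have hutS : ∀ y ∈ S, ut y = u y := fun y hy ↦ by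
    simp only [hut, hψ₀1 y (le_of_lt hy), one_mul]
  have hDutS : ∀ y ∈ S, fderiv ℝ ut y = fderiv ℝ u y := by
    intro y hy
    have hev : ut =ᶠ[𝓝 y] u := by
      filter_upwards [hSo.mem_nhds hy] with z hz
      exact hutS z hz
    exact hev.fderiv_eq
  have hH' : ∫ y in S, u y ^ 2 / ‖y‖ ^ 2 ≤ 4 * ∫ y in S, ‖fderiv ℝ u y‖ ^ 2 := by
    have h1 : ∫ y in S, ut y ^ 2 / ‖y‖ ^ 2 = ∫ y in S, u y ^ 2 / ‖y‖ ^ 2 :=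
      setIntegral_congr_fun hSm fun y hy ↦ by rw [hutS y hy]
    have h2 : ∫ y in S, ‖fderiv ℝ ut y‖ ^ 2 = ∫ y in S, ‖fderiv ℝ u y‖ ^ 2 :=
      setIntegral_congr_fun hSm fun y hy ↦ by rw [hDutS y hy]
    rw [← h1, ← h2]
    exact hH
  -- integrability of `u²/‖y‖²` on `S` (it is `ũ²/‖y‖²`, continuous with compact support off
  -- the ball of radius `a > 0`)
  have hquot : Integrable fun y ↦ ut y ^ 2 / ‖y‖ ^ 2 := by
    have hcont : Continuous fun y ↦ ut y ^ 2 / ‖y‖ ^ 2 := by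
      rw [continuous_iff_continuousAt]
      intro y
      by_cases hy : ‖y‖ < a
      · have hev : (fun y ↦ ut y ^ 2 / ‖y‖ ^ 2) =ᶠ[𝓝 y] fun _ ↦ 0 := by
          filter_upwards [(isOpen_lt continuous_norm continuous_const).mem_nhds hy] with z hz
          simp [hut, hψ₀0 z hz.le]
        exact continuousAt_const.congr_of_eventuallyEq hev
      · have hy0 : ‖y‖ ≠ 0 := by
          intro h
          rw [h] at hy
          exact hy (by rw [ha]; linarith)
        exact ((hut1.continuous.pow 2).continuousAt).div ((continuous_norm.pow 2).continuousAt)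
          (pow_ne_zero 2 hy0)
    refine hcont.integrable_of_hasCompactSupport (hutc.mono fun y hy ↦ ?_)
    rw [mem_support] at hy ⊢
    intro h
    apply hy
    simp [h]
  -- `∫_A u² ≤ (2R₀)² ∫_A u²/‖y‖² ≤ (2R₀)² ∫_S u²/‖y‖²`
  have hut2 : Integrable fun y ↦ ut y ^ 2 :=
    (hut1.continuous.pow 2).integrable_of_hasCompactSupport (hutc.mono fun y hy ↦ by
      rw [mem_support] at hy ⊢
      intro h
      apply hy
      simp [h])
  have hI1 : IntegrableOn (fun y ↦ u y ^ 2) A volume :=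
    hut2.integrableOn.congr_fun (fun y hy ↦ by beta_reduce; rw [hutS y (hAS hy)]) hAm
  have hI2 : IntegrableOn (fun y ↦ (2 * R₀) ^ 2 * (u y ^ 2 / ‖y‖ ^ 2)) A volume :=
    (hquot.const_mul ((2 * R₀) ^ 2)).integrableOn.congr_fun
      (fun y hy ↦ by beta_reduce; rw [hutS y (hAS hy)]) hAm
  have hA1 : ∫ y in A, u y ^ 2 ≤ (2 * R₀) ^ 2 * ∫ y in A, u y ^ 2 / ‖y‖ ^ 2 := by
    rw [← integral_const_mul]
    refine setIntegral_mono_on hI1 hI2 hAm fun y hy ↦ ?_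
    have hy0 : 0 < ‖y‖ := hR₀.trans hy.1
    rw [mul_div_assoc', le_div_iff₀ (pow_pos hy0 2)]
    have h2 : ‖y‖ ^ 2 ≤ (2 * R₀) ^ 2 := pow_le_pow_left₀ hy0.le hy.2 2
    nlinarith [sq_nonneg (u y)]
  have hA2 : ∫ y in A, u y ^ 2 / ‖y‖ ^ 2 ≤ ∫ y in S, u y ^ 2 / ‖y‖ ^ 2 := by
    refine setIntegral_mono_set ?_ (Eventually.of_forall fun y ↦ by positivity)
      (Eventually.of_forall hAS)
    exact (hquot.integrableOn).congr_fun (fun y hy ↦ by beta_reduce; rw [hutS y hy]) hSm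
  calc ∫ y in A, u y ^ 2 ≤ (2 * R₀) ^ 2 * ∫ y in A, u y ^ 2 / ‖y‖ ^ 2 := hA1
    _ ≤ (2 * R₀) ^ 2 * ∫ y in S, u y ^ 2 / ‖y‖ ^ 2 :=
        mul_le_mul_of_nonneg_left hA2 (by positivity)
    _ ≤ (2 * R₀) ^ 2 * (4 * ∫ y in S, ‖fderiv ℝ u y‖ ^ 2) :=
        mul_le_mul_of_nonneg_left hH' (by positivity)
    _ = 16 * R₀ ^ 2 * ∫ y in S, ‖fderiv ℝ u y‖ ^ 2 := by ring

/-! ### The exterior Sobolev inequality -/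

/-- `L²` norms of real functions as square roots of integrals of squares (for square-integrable,
a.e. strongly measurable functions). [folklore] -/
theorem eLpNorm_two_eq_ofReal_sqrt {α : Type*} [MeasurableSpace α] {μ : Measure α} {f : α → ℝ}
    (hf : AEStronglyMeasurable f μ) (hf2 : Integrable (fun x ↦ f x ^ 2) μ) :
    eLpNorm f 2 μ = ENNReal.ofReal (Real.sqrt (∫ x, f x ^ 2 ∂μ)) := by
  have hmem : MemLp f 2 μ := (memLp_two_iff_integrable_sq hf).2 hf2
  rw [hmem.eLpNorm_eq_integral_rpow_norm two_ne_zero ENNReal.ofNat_ne_top]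
  simp only [ENNReal.toReal_ofNat, Real.rpow_two, sq_abs, Real.norm_eq_abs]
  rw [Real.sqrt_eq_rpow, show ((2 : ℝ))⁻¹ = 1 / 2 by norm_num]

/-- **The Sobolev inequality for the truncation to the exterior** (dimension `3`): for
`0 < R < R₀` and `u : E → ℝ` of class `C¹` on `{R < ‖y‖}` vanishing outside some ball, the
truncation `w = (1 − χ_{R₀}) u ∈ C¹_c(E)` (`χ_{R₀}` the cut-off `cutoff R₀`: `w = 0` on
`{‖y‖ ≤ R₀}`, `w = u` on `{2R₀ ≤ ‖y‖}`) satisfies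
`‖w‖_{L⁶(E)} ≤ K (1 + 4c) ‖Du‖_{L²({R₀ < ‖y‖})}` — Gagliardo–Nirenberg–Sobolev for `w` and the
Leibniz bound `‖Dw‖ ≤ ‖Du‖ + (c/R₀)|u| 1_{R₀<‖y‖≤2R₀}` with the annulus estimate
`sq_integral_annulus_le` (Hardy). This is the form used on the end of an asymptotically flat
manifold (Schoen–Yau 1979, proof of Lemma 3.1, p. 63). [cite: SchoenYauPMT1979, proof of Lemma 3.1 (p. 63)] -/
theorem eLpNorm_six_cutoff_mul_le (hE : finrank ℝ E = 3) :
    ∃ c : ℝ, 0 ≤ c ∧ ∀ {u : E → ℝ} {R R₀ : ℝ} (_ : 0 < R) (_ : R < R₀)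
      (_ : ContDiffOn ℝ 1 u {y | R < ‖y‖}) {ρ : ℝ} (_ : ∀ y, ρ ≤ ‖y‖ → u y = 0),
      eLpNorm (fun y ↦ (1 - cutoff R₀ y) * u y) 6 (volume : Measure E) ≤
        SNormLESNormFDerivOfEqConst ℝ (volume : Measure E) 2 * (1 + 4 * ENNReal.ofReal c) *
          eLpNorm (fderiv ℝ u) 2 (volume.restrict {y : E | R₀ < ‖y‖}) := by
  obtain ⟨c, hc0, hc⟩ := exists_norm_fderiv_cutoff_le (E := E)
  refine ⟨c, hc0, fun {u R R₀} hR hRR₀ hu {ρ} hρ ↦ ?_⟩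
  have hR₀ : 0 < R₀ := hR.trans hRR₀
  set S : Set E := {y | R₀ < ‖y‖} with hS
  set A : Set E := {y : E | R₀ < ‖y‖ ∧ ‖y‖ ≤ 2 * R₀} with hA
  have hSo : IsOpen S := isOpen_lt continuous_const continuous_norm
  have hSm : MeasurableSet S := hSo.measurableSet
  have hAm : MeasurableSet A :=
    hSm.inter (isClosed_le continuous_norm continuous_const).measurableSet
  have hAS : A ⊆ S := fun y hy ↦ hy.1
  -- the outer cut-off `ψ = 1 − χ_{R₀}` and `w = ψ u`
  set ψ : E → ℝ := fun y ↦ 1 - cutoff R₀ y with hψ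
  have hψs : ContDiff ℝ 1 ψ := contDiff_const.sub (contDiff_cutoff R₀)
  have hψ0 : ∀ y, ‖y‖ < R₀ → ψ y = 0 := fun y hy ↦ by
    simp only [hψ, cutoff_eq_one hR₀ hy.le, sub_self]
  have hψ1 : ∀ y, 2 * R₀ ≤ ‖y‖ → ψ y = 1 := fun y hy ↦ by
    simp only [hψ, cutoff_eq_zero hR₀ hy, sub_zero]
  have hψb : ∀ y, |ψ y| ≤ 1 := fun y ↦ by
    have h0 := cutoff_nonneg R₀ y
    have h1 := cutoff_le_one R₀ y
    rw [hψ, abs_le]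
    constructor <;> linarith
  have hDψ : ∀ y, ‖fderiv ℝ ψ y‖ ≤ c / R₀ := fun y ↦ by
    have h : fderiv ℝ ψ y = -fderiv ℝ (cutoff R₀) y := by
      rw [hψ, fderiv_const_sub]
    rw [h, norm_neg]
    exact hc R₀ hR₀ y
  set w : E → ℝ := fun y ↦ ψ y * u y with hw
  have hw1 : ContDiff ℝ 1 w := contDiff_cutoff_mul hψs hRR₀ hψ0 hu
  have hwc : HasCompactSupport w := hasCompactSupport_cutoff_mul hρ
  -- GNS for `w`
  have hGNS : eLpNorm w 6 volume ≤
      SNormLESNormFDerivOfEqConst ℝ (volume : Measure E) 2 * eLpNorm (fderiv ℝ w) 2 volume := by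
    have h := eLpNorm_le_eLpNorm_fderiv_of_eq volume hw1 hwc (p := 2) (p' := 6) one_le_two
      (by rw [hE]; norm_num) (by rw [hE]; norm_num)
    exact_mod_cast h
  -- the pointwise Leibniz bound off the two spheres
  set g : E → ℝ := fun y ↦ S.indicator (fun y ↦ ‖fderiv ℝ u y‖) y +
    c / R₀ * A.indicator (fun y ↦ |u y|) y with hg
  have hbound : ∀ y, ‖y‖ ≠ R₀ → ‖y‖ ≠ 2 * R₀ → ‖fderiv ℝ w y‖ ≤ g y := by
    intro y hy1 hy2
    have hgnn : 0 ≤ g y := by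
      simp only [hg]
      refine add_nonneg (indicator_nonneg (fun _ _ ↦ norm_nonneg _) _)
        (mul_nonneg (by positivity) (indicator_nonneg (fun _ _ ↦ abs_nonneg _) _))
    rcases lt_or_gt_of_ne hy1 with hy | hy
    · -- inside: `w = 0` near `y`
      have hev : w =ᶠ[𝓝 y] fun _ ↦ 0 := by
        filter_upwards [(isOpen_lt continuous_norm continuous_const).mem_nhds hy] with z hz
        simp only [hw, hψ0 z hz, zero_mul]
      rw [hev.fderiv_eq, fderiv_const_apply, norm_zero]
      exact hgnn
    · have hyS : y ∈ S := hy
      have hyR : R < ‖y‖ := hRR₀.trans hy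
      have hud : DifferentiableAt ℝ u y :=
        (hu.contDiffAt ((isOpen_lt continuous_const continuous_norm).mem_nhds hyR)).differentiableAt
          one_ne_zero
      have hψd : DifferentiableAt ℝ ψ y := (hψs.differentiable one_ne_zero) y
      rcases lt_or_gt_of_ne hy2 with hy' | hy'
      · -- the annulus: product rule
        have hyA : y ∈ A := ⟨hy, hy'.le⟩
        rw [hw, fderiv_fun_mul hψd hud]
        calc ‖ψ y • fderiv ℝ u y + u y • fderiv ℝ ψ y‖
            ≤ ‖ψ y • fderiv ℝ u y‖ + ‖u y • fderiv ℝ ψ y‖ := norm_add_le _ _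
          _ ≤ ‖fderiv ℝ u y‖ + c / R₀ * |u y| := by
              refine add_le_add ?_ ?_
              · rw [norm_smul, Real.norm_eq_abs]
                exact mul_le_of_le_one_left (norm_nonneg _) (hψb y)
              · rw [norm_smul, Real.norm_eq_abs, mul_comm]
                exact mul_le_mul_of_nonneg_right (hDψ y) (abs_nonneg _)
          _ = g y := by
              simp only [hg, indicator_of_mem hyS, indicator_of_mem hyA]
      · -- far out: `w = u` near `y`
        have hev : w =ᶠ[𝓝 y] u := by
          filter_upwards [(isOpen_lt continuous_const continuous_norm).mem_nhds hy'] with z hz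
          simp only [hw, hψ1 z (le_of_lt hz), one_mul]
        rw [hev.fderiv_eq]
        have hyA : y ∉ A := fun h ↦ not_lt.2 h.2 hy'
        simp only [hg, indicator_of_mem hyS, indicator_of_notMem hyA, mul_zero, add_zero, le_refl]
  have hae : ∀ᵐ y ∂(volume : Measure E), ‖fderiv ℝ w y‖ ≤ g y := by
    have hnull : (volume : Measure E) (sphere (0 : E) R₀ ∪ sphere 0 (2 * R₀)) = 0 := by
      rw [measure_union_null_iff]
      exact ⟨Measure.addHaar_sphere_of_ne_zero _ _ hR₀.ne',
        Measure.addHaar_sphere_of_ne_zero _ _ (by linarith)⟩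
    rw [ae_iff]
    refine measure_mono_null (fun y hy ↦ ?_) hnull
    simp only [mem_setOf_eq, not_le] at hy
    by_contra hys
    simp only [mem_union, mem_sphere_zero_iff_norm, not_or] at hys
    exact absurd (hbound y hys.1 hys.2) (not_le.2 hy)
  -- (1) `‖Dw‖_{L²} ≤ ‖g‖_{L²} ≤ ‖Du‖_{L²(S)} + (c/R₀) ‖u‖_{L²(A)}`
  have hg1m : AEStronglyMeasurable (S.indicator fun y ↦ ‖fderiv ℝ u y‖) (volume : Measure E) :=
    (measurable_fderiv ℝ u).norm.aestronglyMeasurable.indicator hSm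
  have huA : ContinuousOn u A := hu.continuousOn.mono fun y hy ↦ hRR₀.trans hy.1
  have hg2m : AEStronglyMeasurable (fun y ↦ c / R₀ * A.indicator (fun y ↦ |u y|) y)
      (volume : Measure E) := by
    refine aestronglyMeasurable_const.mul ?_
    rw [aestronglyMeasurable_indicator_iff hAm]
    exact (continuous_abs.comp_continuousOn huA).aestronglyMeasurable hAm
  have hDw : eLpNorm (fderiv ℝ w) 2 volume ≤
      eLpNorm (fderiv ℝ u) 2 (volume.restrict S) +
        ENNReal.ofReal (c / R₀) * eLpNorm u 2 (volume.restrict A) := by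
    calc eLpNorm (fderiv ℝ w) 2 volume ≤ eLpNorm g 2 volume := by
          refine eLpNorm_mono_ae (hae.mono fun y hy ↦ hy.trans ?_)
          rw [Real.norm_eq_abs]
          exact le_abs_self _
      _ ≤ eLpNorm (S.indicator fun y ↦ ‖fderiv ℝ u y‖) 2 volume +
            eLpNorm (fun y ↦ c / R₀ * A.indicator (fun y ↦ |u y|) y) 2 volume :=
          eLpNorm_add_le hg1m hg2m one_le_two
      _ = eLpNorm (fderiv ℝ u) 2 (volume.restrict S) +
            ENNReal.ofReal (c / R₀) * eLpNorm u 2 (volume.restrict A) := by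
          congr 1
          · rw [eLpNorm_indicator_eq_eLpNorm_restrict hSm, eLpNorm_norm]
          · have : (fun y ↦ c / R₀ * A.indicator (fun y ↦ |u y|) y) =
                (c / R₀) • A.indicator (fun y ↦ |u y|) := rfl
            rw [this, eLpNorm_const_smul, Real.enorm_eq_ofReal (by positivity),
              eLpNorm_indicator_eq_eLpNorm_restrict hAm]
            congr 1
            have habs : (fun y ↦ |u y|) = fun y ↦ ‖u y‖ := rfl
            rw [habs, eLpNorm_norm]
  -- (2) the annulus: `‖u‖_{L²(A)} ≤ 4 R₀ ‖Du‖_{L²(S)}` in `ℝ≥0∞` form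
  have hKρ : IsCompact {y : E | R₀ ≤ ‖y‖ ∧ ‖y‖ ≤ max (2 * R₀) ρ} := by
    have : {y : E | R₀ ≤ ‖y‖ ∧ ‖y‖ ≤ max (2 * R₀) ρ} =
        closedBall (0 : E) (max (2 * R₀) ρ) ∩ {y | R₀ ≤ ‖y‖} := by
      ext y
      simp only [mem_setOf_eq, mem_inter_iff, mem_closedBall_zero_iff]
      tauto
    rw [this]
    exact (isCompact_closedBall _ _).inter_right (isClosed_le continuous_const continuous_norm)
  have hKsub : {y : E | R₀ ≤ ‖y‖ ∧ ‖y‖ ≤ max (2 * R₀) ρ} ⊆ {y | R < ‖y‖} := fun y hy ↦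
    hRR₀.trans_le hy.1
  have huAint : Integrable (fun y ↦ u y ^ 2) (volume.restrict A) := by
    have h : IntegrableOn (fun y ↦ u y ^ 2) {y : E | R₀ ≤ ‖y‖ ∧ ‖y‖ ≤ max (2 * R₀) ρ} volume :=
      ((hu.continuousOn.pow 2).mono hKsub).integrableOn_compact hKρ
    exact h.mono_set fun y hy ↦ ⟨hy.1.le, hy.2.trans (le_max_left _ _)⟩
  have hDuS : ContinuousOn (fun y ↦ ‖fderiv ℝ u y‖) S :=
    ((hu.continuousOn_fderiv_of_isOpen (isOpen_lt continuous_const continuous_norm) le_rfl).mono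
      fun y hy ↦ hRR₀.trans hy).norm
  have hDuzero : ∀ y : E, ρ < ‖y‖ → fderiv ℝ u y = 0 := by
    intro y hy
    have hev : u =ᶠ[𝓝 y] fun _ ↦ 0 := by
      filter_upwards [(isOpen_lt continuous_const continuous_norm).mem_nhds hy] with z hz
      exact hρ z hz.le
    rw [hev.fderiv_eq, fderiv_const_apply]
  have hDuSint : Integrable (fun y ↦ ‖fderiv ℝ u y‖ ^ 2) (volume.restrict S) := by
    have h1 : IntegrableOn (fun y ↦ ‖fderiv ℝ u y‖ ^ 2) {y : E | R₀ ≤ ‖y‖ ∧ ‖y‖ ≤ max (2 * R₀) ρ}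
        volume :=
      (((hu.continuousOn_fderiv_of_isOpen (isOpen_lt continuous_const continuous_norm)
        le_rfl).norm.pow 2).mono hKsub).integrableOn_compact hKρ
    have hs : S ⊆ {y : E | R₀ ≤ ‖y‖ ∧ ‖y‖ ≤ max (2 * R₀) ρ} ∪ {y : E | max (2 * R₀) ρ < ‖y‖} := by
      intro y hy
      by_cases h : ‖y‖ ≤ max (2 * R₀) ρ
      · exact Or.inl ⟨le_of_lt hy, h⟩
      · exact Or.inr (not_le.1 h)
    refine IntegrableOn.mono_set (h1.union ?_) hs
    refine (integrableOn_zero).congr_fun (fun y hy ↦ ?_)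
      (isOpen_lt continuous_const continuous_norm).measurableSet
    have hyρ : ρ < ‖y‖ := (le_max_right _ _).trans_lt hy
    simp [hDuzero y hyρ]
  have huL2 : eLpNorm u 2 (volume.restrict A) =
      ENNReal.ofReal (Real.sqrt (∫ y in A, u y ^ 2)) :=
    eLpNorm_two_eq_ofReal_sqrt (huA.aestronglyMeasurable hAm) huAint
  have hDuL2 : eLpNorm (fderiv ℝ u) 2 (volume.restrict S) =
      ENNReal.ofReal (Real.sqrt (∫ y in S, ‖fderiv ℝ u y‖ ^ 2)) := by
    rw [← eLpNorm_norm]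
    exact eLpNorm_two_eq_ofReal_sqrt (hDuS.aestronglyMeasurable hSm) hDuSint
  have hann : ENNReal.ofReal (c / R₀) * eLpNorm u 2 (volume.restrict A) ≤
      4 * ENNReal.ofReal c * eLpNorm (fderiv ℝ u) 2 (volume.restrict S) := by
    have hsq := sq_integral_annulus_le hE hR hRR₀ hu hρ
    have hI0 : 0 ≤ ∫ y in S, ‖fderiv ℝ u y‖ ^ 2 := integral_nonneg fun _ ↦ by positivity
    have h1 : Real.sqrt (∫ y in A, u y ^ 2) ≤ 4 * R₀ * Real.sqrt (∫ y in S, ‖fderiv ℝ u y‖ ^ 2) := by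
      calc Real.sqrt (∫ y in A, u y ^ 2)
          ≤ Real.sqrt (16 * R₀ ^ 2 * ∫ y in S, ‖fderiv ℝ u y‖ ^ 2) := Real.sqrt_le_sqrt hsq
        _ = 4 * R₀ * Real.sqrt (∫ y in S, ‖fderiv ℝ u y‖ ^ 2) := by
            rw [Real.sqrt_mul (by positivity), show (16 : ℝ) * R₀ ^ 2 = (4 * R₀) ^ 2 by ring,
              Real.sqrt_sq (by positivity)]
    rw [huL2, hDuL2, ← ENNReal.ofReal_mul (by positivity),
      show (4 : ℝ≥0∞) * ENNReal.ofReal c = ENNReal.ofReal (4 * c) by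
        rw [ENNReal.ofReal_mul (by norm_num), ENNReal.ofReal_ofNat],
      ← ENNReal.ofReal_mul (by positivity)]
    refine ENNReal.ofReal_le_ofReal ?_
    calc c / R₀ * Real.sqrt (∫ y in A, u y ^ 2)
        ≤ c / R₀ * (4 * R₀ * Real.sqrt (∫ y in S, ‖fderiv ℝ u y‖ ^ 2)) :=
          mul_le_mul_of_nonneg_left h1 (by positivity)
      _ = 4 * c * Real.sqrt (∫ y in S, ‖fderiv ℝ u y‖ ^ 2) := by
          field_simp
  -- (3) assemble
  calc eLpNorm w 6 volume
      ≤ SNormLESNormFDerivOfEqConst ℝ (volume : Measure E) 2 * eLpNorm (fderiv ℝ w) 2 volume := hGNS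
    _ ≤ SNormLESNormFDerivOfEqConst ℝ (volume : Measure E) 2 *
          (eLpNorm (fderiv ℝ u) 2 (volume.restrict S) +
            4 * ENNReal.ofReal c * eLpNorm (fderiv ℝ u) 2 (volume.restrict S)) := by
        gcongr
        exact hDw.trans (add_le_add le_rfl hann)
    _ = SNormLESNormFDerivOfEqConst ℝ (volume : Measure E) 2 * (1 + 4 * ENNReal.ofReal c) *
          eLpNorm (fderiv ℝ u) 2 (volume.restrict S) := by ring

/-- **The Sobolev inequality outside a ball, no boundary condition on the inner sphere**
(dimension `3`; Schoen–Yau 1979, proof of Lemma 3.1: "follows from the Euclidean inequality").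
For `0 < R < R₀` and `u : E → ℝ` of class `C¹` on `{R < ‖y‖}` vanishing outside some ball:
`‖u‖_{L⁶({2R₀ < ‖y‖})} ≤ K (1 + 4c) ‖Du‖_{L²({R₀ < ‖y‖})}`, where
`K = SNormLESNormFDerivOfEqConst ℝ volume 2` is the Gagliardo–Nirenberg–Sobolev constant and
`c ≥ 0` is the absolute gradient bound of the cut-off `Fluid.cutoff` (`‖Dχ_r‖ ≤ c/r`). Proof:
GNS (Mathlib's `eLpNorm_le_eLpNorm_fderiv_of_eq`, `n = 3`, `p = 2`, `p' = 6`) for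
`w = (1 − χ_{R₀}) u ∈ C¹_c(E)`, which equals `u` on `{2R₀ ≤ ‖y‖}`, together with the Leibniz bound
`‖Dw‖ ≤ ‖Du‖ + (c/R₀)|u| 1_{R₀<‖y‖≤2R₀}` on `{R₀ < ‖y‖}` (and `Dw = 0` on `{‖y‖ < R₀}`) and the
annulus estimate `sq_integral_annulus_le`. [cite: SchoenYauPMT1979, proof of Lemma 3.1 (p. 63)] -/
theorem eLpNorm_six_exterior_le (hE : finrank ℝ E = 3) :
    ∃ c : ℝ, 0 ≤ c ∧ ∀ {u : E → ℝ} {R R₀ : ℝ} (_ : 0 < R) (_ : R < R₀)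
      (_ : ContDiffOn ℝ 1 u {y | R < ‖y‖}) {ρ : ℝ} (_ : ∀ y, ρ ≤ ‖y‖ → u y = 0),
      eLpNorm u 6 (volume.restrict {y : E | 2 * R₀ < ‖y‖}) ≤
        SNormLESNormFDerivOfEqConst ℝ (volume : Measure E) 2 * (1 + 4 * ENNReal.ofReal c) *
          eLpNorm (fderiv ℝ u) 2 (volume.restrict {y : E | R₀ < ‖y‖}) := by
  obtain ⟨c, hc0, hc⟩ := eLpNorm_six_cutoff_mul_le (E := E) hE
  refine ⟨c, hc0, fun {u R R₀} hR hRR₀ hu {ρ} hρ ↦ ?_⟩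
  have hR₀ : 0 < R₀ := hR.trans hRR₀
  set T : Set E := {y : E | 2 * R₀ < ‖y‖} with hT
  have hTm : MeasurableSet T := (isOpen_lt continuous_const continuous_norm).measurableSet
  -- `u = (1 − χ_{R₀}) u` on `T`
  have hL : eLpNorm u 6 (volume.restrict T) ≤
      eLpNorm (fun y ↦ (1 - cutoff R₀ y) * u y) 6 (volume : Measure E) := by
    have hind : T.indicator u = T.indicator fun y ↦ (1 - cutoff R₀ y) * u y := by
      funext z
      by_cases hz : z ∈ T
      · rw [indicator_of_mem hz, indicator_of_mem hz, cutoff_eq_zero hR₀ (le_of_lt hz), sub_zero,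
          one_mul]
      · rw [indicator_of_notMem hz, indicator_of_notMem hz]
    rw [← eLpNorm_indicator_eq_eLpNorm_restrict hTm, hind]
    exact eLpNorm_indicator_le _
  exact hL.trans (hc hR hRR₀ hu hρ)

end Literature.Analysis.Calculus

end
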